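import Mathlib
import HarnessLib
import Summits.NavierStokesRegularity.NavierStokesRegularity.Theorems.PoloidalWindowRigidity.Negative.StuartVorticity
import Literature.Analysis.FluidPDE.TsaiLocalEnergy

/-!
# Crux K2 `PoloidalWindowRigidity` (stmt-NavierStokesRegularity-19708), skeleton lrc-jet v5 — negative side:
# `stub_untwisted` is FALSE without the Oseen-mild identity

Negative-side support (refuter seat ns-regularity-refuter1, cell ns-regularity-ideate; D-0081 §C), brick K-40.  Skeleton
lrc-jet **v5** (`Cruxes/PoloidalWindowRigidity/Lines/lrc_jet.lean`, K2 lead ns-poloidal-K2-p1 g6) splits the crux by the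
TWIST BRACKET `T = {∂₂v₂, v₂}ₕ = ∂₀(∂₂v₂)·∂₁v₂ − ∂₁(∂₂v₂)·∂₀v₂` of the vortex-line foliation: `stub_untwisted` (non-degenerate +
`T ≡ 0` on a window ⇒ the apex is regular; proved on paper by the lead, UNTWISTED-NOTE.md §3, by separation of variables in the
height using the vertical momentum equation) and `stub_twisting` (research residue).

This file certifies that the Oseen-mild identity (M) is LOAD-BEARING for `stub_untwisted`: the Stuart column of
`…Negative.StuartColumn` / `…Negative.StuartVorticity` (refuter1 g4, K-35) — a poloidal, divergence-free, frozen, real-analytic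
Type-I profile that is backward-singular at the apex — is UNTWISTED: `∂₂v₂ = cot x₂ · v₂`, so `∂₂v₂` is constant along the
vortex lines and the bracket vanishes identically (`stuartProfile_untwisted`).  It realises KINEMATICALLY the «Branch 2»
structure of the lead's proof (the structure function is affine in the reparametrised leaf coordinate), i.e. exactly the
branch that the vertical momentum equation must kill: any proof of `stub_untwisted` uses (M) there.

Contents: `fderiv_stuartProfile_e2_apply_two` (`∂₂v₂` in closed form), `stuartDzVz`/`hasFDerivAt_stuartDzVz` (its
derivative), `stuartProfile_untwisted` (T ≡ 0 everywhere), `isBackwardSingularPoint_stuartProfile` (the apex is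
backward-singular although `V(0) = 0`: `|v₁(t, ρe₁)| ≥ (−t)^{-1/2} sin ρ / 3`), and the packaged negative lemmas
`untwisted_false_without_mild` (hypotheses of `stub_untwisted` VERBATIM minus (M)) and
`untwisted_false_without_mild_frozen_analytic` ((M) replaced by the frozen constraint (F) and slice analyticity (A)).
WHAT THIS IS NOT: not NS, not ¬`stub_untwisted` — the stub minus (M) only. [folklore]
-/

-- the summit and its single sub-problem share the name (CONVENTIONS §1)
set_option linter.dupNamespace false

namespace Summit.NavierStokesRegularity.NavierStokesRegularity.Theorems.PoloidalWindowRigidity.Negative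

open MeasureTheory Set Function Filter Topology Metric
open scoped RealInnerProductSpace InnerProductSpace
open Literature.Analysis Literature.Analysis.FluidPDE

local notation "E3" => EuclideanSpace ℝ (Fin 3)
local notation "π" i => (EuclideanSpace.proj (𝕜 := ℝ) (i : Fin 3) : EuclideanSpace ℝ (Fin 3) →L[ℝ] ℝ)
local notation "𝐞" i => (EuclideanSpace.single (i : Fin 3) (1 : ℝ) : EuclideanSpace ℝ (Fin 3))

/-! ## `∂₂v₂` and the twist bracket -/

/-- The height-derivative pattern of the vertical velocity: `Z(x) = cos x₂ · W⁻²` (`∂₂v₂ = −3(−t)^{-1/2} Z`). [folklore] -/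
noncomputable def stuartDzVz (x : E3) : ℝ := Real.cos (x 2) * (stuartW x)⁻¹ ^ 2

/-- `∂₂ v₂ = −3 (−t)^{-1/2} cos x₂ / W²`. [folklore] -/
theorem fderiv_stuartProfile_e2_apply_two (t : ℝ) (x : E3) :
    fderiv ℝ (stuartProfile t) x (𝐞 2) 2 = cellAmp t * (-3) * stuartDzVz x := by
  rw [fderiv_stuartProfile_apply, stuartDeriv_apply_two, stuartDzVz]
  simp
  ring

/-- `∂₂v₂` as a function of the point. [folklore] -/
theorem fderiv_stuartProfile_e2_two_eq (t : ℝ) :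
    (fun x : E3 => fderiv ℝ (stuartProfile t) x (𝐞 2) 2) = fun x => cellAmp t * (-3) * stuartDzVz x :=
  funext (fderiv_stuartProfile_e2_apply_two t)

/-- The derivative of `Z`: `dZ = −sin x₂ W⁻² dx₂ − 2 cos x₂ W⁻³ dW`. [folklore] -/
noncomputable def stuartDzVzDeriv (x : E3) : E3 →L[ℝ] ℝ :=
  ((stuartW x)⁻¹ ^ 2) • ((-(Real.sin (x 2))) • (π 2)) +
    Real.cos (x 2) • ((-(2 * (stuartW x)⁻¹ ^ 3)) •
      (Real.exp (x 0) • (π 0) + Real.exp (-(x 0)) • (-(π 0)) + (-(Real.sin (x 1))) • (π 1)))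

/-- `dZ(x) w` in coordinates. [folklore] -/
theorem stuartDzVzDeriv_apply (x w : E3) : stuartDzVzDeriv x w =
    (stuartW x)⁻¹ ^ 2 * (-(Real.sin (x 2)) * w 2) +
      Real.cos (x 2) * (-(2 * (stuartW x)⁻¹ ^ 3) *
        (Real.exp (x 0) * w 0 + Real.exp (-(x 0)) * (-(w 0)) + (-(Real.sin (x 1))) * w 1)) := by
  simp only [stuartDzVzDeriv, smul_apply, add_apply, neg_apply, smul_eq_mul, PiLp.proj_apply]

/-- `Z` is differentiable with derivative `stuartDzVzDeriv`. [folklore] -/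
theorem hasFDerivAt_stuartDzVz (x : E3) : HasFDerivAt stuartDzVz (stuartDzVzDeriv x) x := by
  have hW := stuartW_ne_zero x
  have h2 : HasFDerivAt (fun z : E3 => z 2) (π 2) x := (π 2).hasFDerivAt
  have hc2 := (Real.hasDerivAt_cos (x 2)).comp_hasFDerivAt x h2
  have hinv := (hasDerivAt_inv hW).comp_hasFDerivAt x (hasFDerivAt_stuartW x)
  have H : HasFDerivAt stuartDzVz _ x := hc2.mul (hinv.pow 2)
  refine H.congr_fderiv ?_
  ext w
  rw [stuartDzVzDeriv_apply]
  simp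
  field_simp
  ring

/-- `x ↦ ∂₂v₂(t, x)` is differentiable with derivative `−3(−t)^{-1/2} dZ`. [folklore] -/
theorem hasFDerivAt_fderiv_stuartProfile_e2_two (t : ℝ) (x : E3) :
    HasFDerivAt (fun y : E3 => fderiv ℝ (stuartProfile t) y (𝐞 2) 2) ((cellAmp t * (-3)) • stuartDzVzDeriv x) x := by
  rw [fderiv_stuartProfile_e2_two_eq]
  exact (hasFDerivAt_stuartDzVz x).const_mul (cellAmp t * (-3))

/-- **The Stuart column is UNTWISTED**: the twist bracket `∂₀(∂₂v₂)·∂₁v₂ − ∂₁(∂₂v₂)·∂₀v₂` vanishes at every space–time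
point (`∂₂v₂ = cot x₂ · v₂` is constant along the vortex lines `{W = c} × {x₂ = h}`). [folklore] -/
theorem stuartProfile_untwisted (z : ℝ × E3) :
    fderiv ℝ (fun x => fderiv ℝ (stuartProfile z.1) x (𝐞 2) 2) z.2 (𝐞 0) *
          fderiv ℝ (stuartProfile z.1) z.2 (𝐞 1) 2 -
        fderiv ℝ (fun x => fderiv ℝ (stuartProfile z.1) x (𝐞 2) 2) z.2 (𝐞 1) *
          fderiv ℝ (stuartProfile z.1) z.2 (𝐞 0) 2 = 0 := by
  have a0 : ((𝐞 0) : E3) 0 = 1 := by simp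
  have a1 : ((𝐞 0) : E3) 1 = 0 := by simp
  have a2 : ((𝐞 0) : E3) 2 = 0 := by simp
  have b0 : ((𝐞 1) : E3) 0 = 0 := by simp
  have b1 : ((𝐞 1) : E3) 1 = 1 := by simp
  have b2 : ((𝐞 1) : E3) 2 = 0 := by simp
  rw [(hasFDerivAt_fderiv_stuartProfile_e2_two z.1 z.2).fderiv, smul_apply, smul_apply, stuartDzVzDeriv_apply,
    stuartDzVzDeriv_apply, a0, a1, a2, b0, b1, b2, fderiv_stuartProfile_e0_apply_two,
    fderiv_stuartProfile_e1_apply_two, smul_eq_mul, smul_eq_mul]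
  ring

/-! ## The apex is backward-singular -/

/-- The second component of the profile: `v₁(t, x) = −(−t)^{-1/2} cos x₂ sin x₁ / W`. [folklore] -/
theorem stuartProfile_apply_one (t : ℝ) (x : E3) :
    stuartProfile t x 1 = cellAmp t * (-(Real.cos (x 2) * Real.sin (x 1) * (stuartW x)⁻¹)) := by
  simp only [stuartProfile, PiLp.smul_apply, smul_eq_mul, stuartField_apply_one]

/-- **The Stuart profile is backward-singular at the apex** although `V(0) = 0`: at the points `(t, ρ e₁)`,
`0 < ρ ≤ 1`, one has `|v₁| = (−t)^{-1/2} sin ρ/(2 + cos ρ) ≥ (−t)^{-1/2} sin ρ / 3`, which exceeds every level for `t`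
close to `0⁻`; continuity then gives essential unboundedness on every parabolic cylinder `Q_r(0,0)`
(`isBackwardSingularPoint_of_forall_exists_continuousAt`). [folklore] -/
theorem isBackwardSingularPoint_stuartProfile : IsBackwardSingularPoint stuartProfile 0 := by
  apply isBackwardSingularPoint_of_forall_exists_continuousAt
  intro r hr M
  -- the spatial point `y = ρ e₁`
  set ρ : ℝ := min (r / 2) 1 with hρdef
  have hρpos : 0 < ρ := lt_min (by positivity) one_pos
  have hρr : ρ ≤ r / 2 := min_le_left _ _
  have hρ1 : ρ ≤ 1 := min_le_right _ _
  set y : E3 := ρ • (𝐞 1) with hydef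
  have y0 : y 0 = 0 := by simp [hydef]
  have y1 : y 1 = ρ := by simp [hydef]
  have y2 : y 2 = 0 := by simp [hydef]
  have hW : stuartW y = 2 + Real.cos ρ := by
    simp only [stuartW, y0, y1, neg_zero, Real.exp_zero]; ring
  have hWpos : 0 < stuartW y := stuartW_pos y
  have hW3 : stuartW y ≤ 3 := by rw [hW]; linarith [Real.cos_le_one ρ]
  have hsin : 0 < Real.sin ρ := Real.sin_pos_of_pos_of_lt_pi hρpos (by linarith [Real.pi_gt_three])
  -- the level: `δ = sin ρ / 3`
  set δ : ℝ := Real.sin ρ / 3 with hδdef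
  have hδ : 0 < δ := by positivity
  set K : ℝ := |M| + 1 with hKdef
  have hK : 0 < K := by positivity
  have hMK : M < K := by rw [hKdef]; linarith [le_abs_self M]
  -- the time: `t = −τ`
  set τ : ℝ := min (r ^ 2 / 2) ((δ / K) ^ 2 / 2) with hτdef
  have hτpos : 0 < τ := lt_min (by positivity) (by positivity)
  have hτr : τ < r ^ 2 := lt_of_le_of_lt (min_le_left _ _) (by nlinarith)
  have hτK : τ < (δ / K) ^ 2 := lt_of_le_of_lt (min_le_right _ _) (by nlinarith [div_pos hδ hK])
  have hsqrt : Real.sqrt τ < δ / K := by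
    rw [Real.sqrt_lt' (div_pos hδ hK)]
    exact hτK
  have hsqrtpos : 0 < Real.sqrt τ := Real.sqrt_pos.2 hτpos
  have hamp : cellAmp (-τ) = (Real.sqrt τ)⁻¹ := by simp [cellAmp]
  refine ⟨((-τ : ℝ), y), ?_, ?_, ?_⟩
  · -- membership in the parabolic cylinder
    rw [mem_parabolicCylinder]
    refine ⟨⟨?_, ?_⟩, ?_⟩
    · simp only [Prod.fst_zero]; linarith
    · simp only [Prod.fst_zero]; linarith
    · simp only [Prod.snd_zero, dist_zero_right, hydef, norm_smul, Real.norm_eq_abs, abs_of_pos hρpos,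
        PiLp.norm_single, norm_one, mul_one]
      linarith
  · -- continuity at `(−τ, y)` (the profile is jointly continuous on the open backward slab)
    exact continuousOn_stuartProfile.continuousAt
      ((isOpen_Iio.prod isOpen_univ).mem_nhds ⟨by simp [hτpos], Set.mem_univ _⟩)
  · -- the level is exceeded
    have hcomp : stuartProfile (-τ) y 1 = -((Real.sqrt τ)⁻¹ * (Real.sin ρ * (stuartW y)⁻¹)) := by
      rw [stuartProfile_apply_one, hamp, y2, y1, Real.cos_zero, one_mul]; ring
    have hlow : (Real.sqrt τ)⁻¹ * δ ≤ ‖stuartProfile (-τ) y‖ := by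
      have hWinv : (1 : ℝ) / 3 ≤ (stuartW y)⁻¹ := by
        rw [one_div]
        exact inv_anti₀ hWpos hW3
      have h1 : (Real.sqrt τ)⁻¹ * δ ≤ (Real.sqrt τ)⁻¹ * (Real.sin ρ * (stuartW y)⁻¹) := by
        apply mul_le_mul_of_nonneg_left _ (inv_nonneg.2 hsqrtpos.le)
        rw [hδdef]
        have := mul_le_mul_of_nonneg_left hWinv hsin.le
        linarith [this]
      calc (Real.sqrt τ)⁻¹ * δ ≤ (Real.sqrt τ)⁻¹ * (Real.sin ρ * (stuartW y)⁻¹) := h1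
        _ = |stuartProfile (-τ) y 1| := by
            rw [hcomp, abs_neg, abs_of_nonneg]
            exact mul_nonneg (inv_nonneg.2 hsqrtpos.le) (mul_nonneg hsin.le (inv_nonneg.2 hWpos.le))
        _ = ‖stuartProfile (-τ) y 1‖ := (Real.norm_eq_abs _).symm
        _ ≤ ‖stuartProfile (-τ) y‖ := PiLp.norm_apply_le _ 1
    have hKlt : K < (Real.sqrt τ)⁻¹ * δ := by
      rw [← div_eq_inv_mul, lt_div_iff₀ hsqrtpos]
      calc K * Real.sqrt τ < K * (δ / K) := mul_lt_mul_of_pos_left hsqrt hK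
        _ = δ := by field_simp
    show M < ‖stuartProfile (-τ) y‖
    linarith

/-! ## `stub_untwisted` without the Oseen-mild identity is false -/

/-- **`stub_untwisted` of skeleton lrc-jet v5 is FALSE without the Oseen-mild identity (M).**  The hypotheses are those of
`stub_untwisted` VERBATIM with (M) deleted — Type-I rate (R), continuity (C), divergence-free (D), poloidal (P); a non-empty
open window of the backward slab on which the three non-degeneracy pins hold and the twist bracket vanishes — and the
conclusion `¬ IsBackwardSingularPoint v 0` fails for the Stuart column (`C = 6`, window `stuartWindow`): untwisted everywhere,
singular at the apex.  Reading: (M) is load-bearing for the untwisted stub — its kinematic shadow is exactly the Stuart /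
Branch-2 structure of the lead's proof. [folklore] -/
theorem untwisted_false_without_mild :
    ¬ (∀ (C : ℝ) (v : ℝ → EuclideanSpace ℝ (Fin 3) → EuclideanSpace ℝ (Fin 3)),
      Literature.Analysis.FluidPDE.HasTypeITimeDecay C v →
      ContinuousOn (Function.uncurry v) (Set.Iio (0 : ℝ) ×ˢ Set.univ) →
      (∀ t < 0, Literature.Analysis.FluidPDE.VectorCalculus.IsDivFree (v t)) →
      (∀ s < 0, ∀ y, ⟪Literature.Analysis.FluidPDE.curl (v s) y, EuclideanSpace.single 2 1⟫_ℝ = 0) →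
      ∀ W : Set (ℝ × EuclideanSpace ℝ (Fin 3)), IsOpen W → W.Nonempty → W ⊆ Set.Iio (0 : ℝ) ×ˢ Set.univ →
        (∀ z ∈ W, Literature.Analysis.FluidPDE.curl (v z.1) z.2 ≠ 0 ∧
          (fderiv ℝ (v z.1) z.2 (EuclideanSpace.single 0 1) 2 ≠ 0 ∨ fderiv ℝ (v z.1) z.2 (EuclideanSpace.single 1 1) 2 ≠ 0) ∧
          (fderiv ℝ (v z.1) z.2 (EuclideanSpace.single 2 1) 0 ≠ 0 ∨ fderiv ℝ (v z.1) z.2 (EuclideanSpace.single 2 1) 1 ≠ 0)) →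
        (∀ z ∈ W,
          fderiv ℝ (fun x => fderiv ℝ (v z.1) x (EuclideanSpace.single 2 1) 2) z.2 (EuclideanSpace.single 0 1) *
              fderiv ℝ (v z.1) z.2 (EuclideanSpace.single 1 1) 2 -
            fderiv ℝ (fun x => fderiv ℝ (v z.1) x (EuclideanSpace.single 2 1) 2) z.2 (EuclideanSpace.single 1 1) *
              fderiv ℝ (v z.1) z.2 (EuclideanSpace.single 0 1) 2 = 0) →
        ¬ Literature.Analysis.FluidPDE.IsBackwardSingularPoint v 0) := by
  intro H
  exact H 6 stuartProfile hasTypeITimeDecay_stuartProfile continuousOn_stuartProfile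
    (fun t _ => isDivFree_stuartProfile t) (fun s _ y => poloidal_stuartProfile s y)
    stuartWindow isOpen_stuartWindow stuartWindow_nonempty stuartWindow_subset stuartProfile_pins
    (fun z _ => stuartProfile_untwisted z) isBackwardSingularPoint_stuartProfile

/-- **The same, EVEN GRANTED the frozen Clebsch structure and real-analytic slices** ((M) REPLACED by (F) the frozen
constraint `⟪Dv(s)(y)·curl v(s)(y), e₂⟫ = 0` and (A) real-analyticity of every slice, both consequences of (M) in the
class): still false on the same witness (`frozen_stuartProfile`, `analyticOnNhd_stuartProfile`). [folklore] -/
theorem untwisted_false_without_mild_frozen_analytic :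
    ¬ (∀ (C : ℝ) (v : ℝ → EuclideanSpace ℝ (Fin 3) → EuclideanSpace ℝ (Fin 3)),
      Literature.Analysis.FluidPDE.HasTypeITimeDecay C v →
      ContinuousOn (Function.uncurry v) (Set.Iio (0 : ℝ) ×ˢ Set.univ) →
      (∀ t < 0, Literature.Analysis.FluidPDE.VectorCalculus.IsDivFree (v t)) →
      (∀ s < 0, ∀ y, ⟪Literature.Analysis.FluidPDE.curl (v s) y, EuclideanSpace.single 2 1⟫_ℝ = 0) →
      (∀ s < 0, ∀ y, ⟪fderiv ℝ (v s) y (Literature.Analysis.FluidPDE.curl (v s) y), EuclideanSpace.single 2 1⟫_ℝ = 0) →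
      (∀ s < 0, AnalyticOnNhd ℝ (v s) Set.univ) →
      ∀ W : Set (ℝ × EuclideanSpace ℝ (Fin 3)), IsOpen W → W.Nonempty → W ⊆ Set.Iio (0 : ℝ) ×ˢ Set.univ →
        (∀ z ∈ W, Literature.Analysis.FluidPDE.curl (v z.1) z.2 ≠ 0 ∧
          (fderiv ℝ (v z.1) z.2 (EuclideanSpace.single 0 1) 2 ≠ 0 ∨ fderiv ℝ (v z.1) z.2 (EuclideanSpace.single 1 1) 2 ≠ 0) ∧
          (fderiv ℝ (v z.1) z.2 (EuclideanSpace.single 2 1) 0 ≠ 0 ∨ fderiv ℝ (v z.1) z.2 (EuclideanSpace.single 2 1) 1 ≠ 0)) →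
        (∀ z ∈ W,
          fderiv ℝ (fun x => fderiv ℝ (v z.1) x (EuclideanSpace.single 2 1) 2) z.2 (EuclideanSpace.single 0 1) *
              fderiv ℝ (v z.1) z.2 (EuclideanSpace.single 1 1) 2 -
            fderiv ℝ (fun x => fderiv ℝ (v z.1) x (EuclideanSpace.single 2 1) 2) z.2 (EuclideanSpace.single 1 1) *
              fderiv ℝ (v z.1) z.2 (EuclideanSpace.single 0 1) 2 = 0) →
        ¬ Literature.Analysis.FluidPDE.IsBackwardSingularPoint v 0) := by
  intro H
  exact H 6 stuartProfile hasTypeITimeDecay_stuartProfile continuousOn_stuartProfile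
    (fun t _ => isDivFree_stuartProfile t) (fun s _ y => poloidal_stuartProfile s y)
    (fun s _ y => frozen_stuartProfile s y) (fun s _ => analyticOnNhd_stuartProfile s)
    stuartWindow isOpen_stuartWindow stuartWindow_nonempty stuartWindow_subset stuartProfile_pins
    (fun z _ => stuartProfile_untwisted z) isBackwardSingularPoint_stuartProfile

end Summit.NavierStokesRegularity.NavierStokesRegularity.Theorems.PoloidalWindowRigidity.Negative
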